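import Literature.MathematicalPhysics.QuantumFieldTheory.Chatterjee2019LargeN.CoeffCatalanBound
import Literature.MathematicalPhysics.QuantumFieldTheory.Chatterjee2019LargeN.RealAnalyticity
import HarnessLib

/-!
# Chatterjee 2019, Corollary 3.3 with the constants the printed tools give uniformly: a perimeter × area law

S. Chatterjee, *Rigorous solution of strongly coupled `SO(N)` lattice gauge theory in the large `N` limit*,
Comm. Math. Phys. **366** (2019) 203–268 (arXiv:1502.07719), Corollary 3.3 (area law upper bound in the 't Hooft
limit: «`lim |⟨W_l⟩|/N ≤ (C(d)|β|)^{area(l)}`») and its proof in §14 («by Theorem 3.1 there is a constant `C(l)`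
such that `|a_k(l)| ≤ C(l)^k` … since `a_k(l) = 0` for `k < area(l)` (Lemma 14.1) …»), Lemma 10.1 (Catalan bound
`|a_k(s)| ≤ K(d)^{5k+ι(s)} Π C_{|lᵢ|−1}`).

The tree's named fact `AreaLawUpperBound` types the printed STATEMENT (a constant depending only on `d`); the printed
PROOF yields a loop-dependent constant (`AreaLowerBound.areaLawUpperBound_loopwise`, flag 3.6 of the cell's literature
index). This file records, as THEOREMS, exactly what the printed tools give with constants depending ONLY on `d`:
combining Corollary 3.5 (`RealAnalyticityStrongCoupling`), Lemma 14.1 (`coeffA_singleton_eq_zero_of_lt_area`) and the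
DISCHARGED Lemma 10.1 (`CoeffCatalanBound_holds`, `K = 2 + 1024(d−1)`; `C_n ≤ 4ⁿ`) one gets
`|a_k((l))| ≤ (4K)^{|l|} (K⁵)^k` (`abs_coeffA_singleton_le`) and hence, for `|β| ≤ min(β₀, 1/(2K⁵))`,
`lim |⟨W_l⟩|/N ≤ 2(4K)^{|l|}(2K⁵|β|)^{area(l)} ≤ C^{|l|} (C|β|)^{area(l)}` with `C = 8K⁵`
(★ `areaLawUpperBound_perimeter`; from Theorem 3.1 alone: `areaLawUpperBound_perimeter_of_gaugeStringDuality`) — an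
area law with a PERIMETER factor `C^{|l|}`, uniform in the loop.

## WHAT THIS IS NOT
Not the printed Corollary 3.3 (no perimeter factor there): `AreaLawUpperBound` stays a named fact. Nothing here concerns
finite `N` or four-dimensional Yang–Mills in the continuum.
-/

noncomputable section

open Filter Topology
open Literature.Probability.LatticeModels Literature.MathematicalPhysics.QuantumLattice

namespace Literature.MathematicalPhysics.QuantumFieldTheory.Chatterjee2019LargeN

variable {d : ℕ}

/-- **Lemma 10.1 for a one-loop sequence, with the Catalan number bounded by `4^{|l|}`**: there is `K = K(d) ≥ 1` with
`|a_k((l))| ≤ (4K)^{|l|} (K⁵)^k` for every genuine non-null loop `l` and every `k` (`ι((l)) = |l| − 1`, `C_{|l|−1} ≤ 4^{|l|−1}`).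
[cite: Chatterjee2019LargeN, Lemma 10.1; §10 (inequality (catalan2): C_{i+1} ≤ 4C_i)] -/
theorem abs_coeffA_singleton_le (hd : 2 ≤ d) : ∃ K : ℝ, 1 ≤ K ∧ ∀ l : Word d, IsLoop l → l ≠ [] → ∀ k : ℕ,
    |coeffA [l] k| ≤ (4 * K) ^ l.length * (K ^ 5) ^ k := by
  obtain ⟨K, hK1, hK⟩ := CoeffCatalanBound_holds d hd
  refine ⟨K, hK1, fun l hl hne k => ?_⟩
  have hs : IsLoopSeq [l] := fun l' hl' => by
    rw [List.mem_singleton] at hl'; subst hl'; exact ⟨hl, hne⟩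
  have h := hK [l] hs k
  have hidx : LoopSeq.index [l] ≤ l.length := by
    simp only [LoopSeq.index, LoopSeq.len, LoopSeq.size, List.map_cons, List.map_nil, List.sum_cons, List.sum_nil,
      List.length_singleton]
    omega
  have hcat : (([l] : LoopSeq d).map fun l => (catalan (l.length - 1) : ℝ)).prod ≤ 4 ^ l.length := by
    simp only [List.map_cons, List.map_nil, List.prod_cons, List.prod_nil, mul_one]
    have h4 := CoeffCatalanBoundProof.catalan_add_le 0 (l.length - 1)
    rw [zero_add, catalan_zero, mul_one] at h4
    calc (catalan (l.length - 1) : ℝ) ≤ ((4 ^ (l.length - 1) : ℕ) : ℝ) := by exact_mod_cast h4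
      _ = (4 : ℝ) ^ (l.length - 1) := by push_cast; ring
      _ ≤ 4 ^ l.length := pow_le_pow_right₀ (by norm_num) (Nat.sub_le _ _)
  have hprod0 : 0 ≤ (([l] : LoopSeq d).map fun l => (catalan (l.length - 1) : ℝ)).prod := by
    simp only [List.map_cons, List.map_nil, List.prod_cons, List.prod_nil, mul_one]
    positivity
  calc |coeffA [l] k| ≤ K ^ (5 * k + LoopSeq.index [l]) * (([l] : LoopSeq d).map fun l => (catalan (l.length - 1) : ℝ)).prod := h
    _ ≤ K ^ (5 * k + l.length) * 4 ^ l.length :=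
        mul_le_mul (pow_le_pow_right₀ hK1 (by omega)) hcat hprod0 (by positivity)
    _ = (4 * K) ^ l.length * (K ^ 5) ^ k := by
        rw [mul_pow, pow_add, pow_mul]; ring

/-- ★ **Corollary 3.3 with uniform constants and a perimeter factor** («area law upper bound in the 't Hooft limit»,
the form the printed §14 argument + Lemma 10.1 yield with `C = C(d)`): assuming Corollary 3.5
(`RealAnalyticityStrongCoupling`), for `d ≥ 2` there are `β₁, C > 0` (depending only on `d`) such that for every
exhaustion, every `|β| ≤ β₁` and every genuine non-null loop `l`, `L = lim_N |⟨W_l⟩_{Λ_N,N,β}|/N` exists and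
`L ≤ C^{|l|} (C|β|)^{area(l)}`. [cite: Chatterjee2019LargeN, Corollary 3.3; §14 (proof of Corollary 3.3); Lemma 10.1; Lemma 14.1] -/
theorem areaLawUpperBound_perimeter (h : RealAnalyticityStrongCoupling d) (hd : 2 ≤ d) :
    ∃ β₁ C : ℝ, 0 < β₁ ∧ 0 < C ∧
      ∀ Λ : ℕ → Finset (Literature.Probability.LatticeModels.Site d), IsExhaustion Λ →
        ∀ β : ℝ, |β| ≤ β₁ →
          ∀ l : Word d, IsLoop l → l ≠ [] →
            ∃ L : ℝ,
              Tendsto (fun N : ℕ => |soExpect N β (Λ N) (wilsonLoopVar N l)| / N) atTop (𝓝 L) ∧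
                L ≤ C ^ l.length * (C * |β|) ^ area l := by
  obtain ⟨β₀, hβ₀, H⟩ := h hd
  obtain ⟨K, hK1, hK⟩ := abs_coeffA_singleton_le hd
  have hK0 : 0 < K := by linarith
  have hK5 : 0 < K ^ 5 := by positivity
  refine ⟨min β₀ (1 / (2 * K ^ 5)), 8 * K ^ 5, lt_min hβ₀ (by positivity), by positivity,
    fun Λ hΛ β hβ l hl hne => ?_⟩
  have hβ0' : |β| ≤ β₀ := hβ.trans (min_le_left _ _)
  have hβK : |β| ≤ 1 / (2 * K ^ 5) := hβ.trans (min_le_right _ _)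
  have hs : IsLoopSeq [l] := fun l' hl' => by
    rw [List.mem_singleton] at hl'; subst hl'; exact ⟨hl, hne⟩
  obtain ⟨hsum, hlim⟩ := H Λ hΛ β hβ0' [l] hs (List.cons_ne_nil _ _)
  refine ⟨|∑' k : ℕ, coeffA [l] k * β ^ k|, ?_, ?_⟩
  · have := hlim.abs
    refine this.congr fun N => ?_
    rw [phi_singleton, abs_div, Nat.abs_cast]
  · -- majorant `c · 2^A · (1/2)^k`, `c = (4K)^{|l|} (K⁵|β|)^A`, using `a_k = 0` for `k < A = area l`
    set A := area l with hA
    set q : ℝ := K ^ 5 * |β| with hq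
    have hq0 : 0 ≤ q := by positivity
    have hq1 : q ≤ 1 / 2 := by
      rw [hq]
      calc K ^ 5 * |β| ≤ K ^ 5 * (1 / (2 * K ^ 5)) := mul_le_mul_of_nonneg_left hβK hK5.le
        _ = 1 / 2 := by field_simp
    set c : ℝ := (4 * K) ^ l.length * q ^ A with hc
    have hc0 : 0 ≤ c := by positivity
    have hterm : ∀ k : ℕ, ‖coeffA [l] k * β ^ k‖ ≤ c * 2 ^ A * (1 / 2) ^ k := by
      intro k
      rw [Real.norm_eq_abs, abs_mul, abs_pow]
      by_cases hk : k < A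
      · rw [coeffA_singleton_eq_zero_of_lt_area l hk, abs_zero, zero_mul]
        positivity
      · rw [not_lt] at hk
        have h1 := hK l hl hne k
        have hqk : q ^ k = q ^ A * q ^ (k - A) := by rw [← pow_add, Nat.add_sub_cancel' hk]
        have hhalf : q ^ (k - A) ≤ (1 / 2) ^ (k - A) := pow_le_pow_left₀ hq0 hq1 _
        have h2k : (1 / 2 : ℝ) ^ (k - A) = 2 ^ A * (1 / 2) ^ k := by
          have : (1 / 2 : ℝ) ^ k = (1 / 2) ^ A * (1 / 2) ^ (k - A) := by rw [← pow_add, Nat.add_sub_cancel' hk]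
          rw [this, ← mul_assoc, ← mul_pow]; norm_num
        calc |coeffA [l] k| * |β| ^ k ≤ (4 * K) ^ l.length * (K ^ 5) ^ k * |β| ^ k :=
              mul_le_mul_of_nonneg_right h1 (by positivity)
          _ = (4 * K) ^ l.length * q ^ k := by rw [hq, mul_pow]; ring
          _ = (4 * K) ^ l.length * (q ^ A * q ^ (k - A)) := by rw [hqk]
          _ ≤ (4 * K) ^ l.length * (q ^ A * (1 / 2) ^ (k - A)) :=
              mul_le_mul_of_nonneg_left (mul_le_mul_of_nonneg_left hhalf (by positivity)) (by positivity)
          _ = c * 2 ^ A * (1 / 2) ^ k := by rw [h2k, hc]; ring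
    have hgeo : HasSum (fun k : ℕ => c * 2 ^ A * (1 / 2 : ℝ) ^ k) (c * 2 ^ A * 2) := by
      have h := (hasSum_geometric_of_lt_one (by norm_num : (0 : ℝ) ≤ 1 / 2) (by norm_num)).mul_left (c * 2 ^ A)
      rwa [show (1 - (1 / 2 : ℝ))⁻¹ = 2 by norm_num] at h
    have hmain : |∑' k : ℕ, coeffA [l] k * β ^ k| ≤ c * 2 ^ A * 2 := by
      rw [← Real.norm_eq_abs]
      exact tsum_of_norm_bounded hgeo hterm
    -- `2 c 2^A = 2 (4K)^{|l|} (2K⁵|β|)^A ≤ (8K⁵)^{|l|} (8K⁵|β|)^A`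
    have hlen : 1 ≤ l.length := List.length_pos_iff.2 hne
    have hKK : K ≤ K ^ 5 := le_self_pow₀ hK1 (by norm_num)
    have h1 : 2 * (4 * K) ^ l.length ≤ (8 * K ^ 5) ^ l.length := by
      have h2 : (2 : ℝ) ≤ 2 ^ l.length := le_self_pow₀ (by norm_num) (by omega)
      calc 2 * (4 * K) ^ l.length ≤ 2 ^ l.length * (4 * K ^ 5) ^ l.length := by
            apply mul_le_mul h2 (pow_le_pow_left₀ (by positivity) (by linarith) _) (by positivity) (by positivity)
        _ = (8 * K ^ 5) ^ l.length := by rw [← mul_pow]; ring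
    have h2 : (2 * q) ^ A ≤ (8 * K ^ 5 * |β|) ^ A := by
      apply pow_le_pow_left₀ (by positivity)
      rw [hq]; nlinarith [abs_nonneg β, hK5]
    calc |∑' k : ℕ, coeffA [l] k * β ^ k| ≤ c * 2 ^ A * 2 := hmain
      _ = (2 * (4 * K) ^ l.length) * (2 * q) ^ A := by rw [hc, mul_pow]; ring
      _ ≤ (8 * K ^ 5) ^ l.length * (8 * K ^ 5 * |β|) ^ A :=
          mul_le_mul h1 h2 (by positivity) (by positivity)

/-- **The perimeter × area law from Theorem 3.1 alone** (`GaugeStringDuality → …`, through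
`realAnalyticity_of_gaugeStringDuality`). [cite: Chatterjee2019LargeN, Corollary 3.3 («an easy corollary of Theorem 3.1»), §14, Lemma 10.1] -/
theorem areaLawUpperBound_perimeter_of_gaugeStringDuality (h : GaugeStringDuality d) (hd : 2 ≤ d) :
    ∃ β₁ C : ℝ, 0 < β₁ ∧ 0 < C ∧
      ∀ Λ : ℕ → Finset (Literature.Probability.LatticeModels.Site d), IsExhaustion Λ →
        ∀ β : ℝ, |β| ≤ β₁ →
          ∀ l : Word d, IsLoop l → l ≠ [] →
            ∃ L : ℝ,
              Tendsto (fun N : ℕ => |soExpect N β (Λ N) (wilsonLoopVar N l)| / N) atTop (𝓝 L) ∧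
                L ≤ C ^ l.length * (C * |β|) ^ area l :=
  areaLawUpperBound_perimeter (realAnalyticity_of_gaugeStringDuality h) hd

end Literature.MathematicalPhysics.QuantumFieldTheory.Chatterjee2019LargeN

end
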